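import Summits.QuantumFields.YangMills.Theorems.BalabanUVNodesN15TwoSpacingGluingNeumannKnit
import Summits.QuantumFields.YangMills.Theorems.BalabanUVNodesN15TwoSpacingGluingCutRowsDefectCover
import Summits.QuantumFields.YangMills.Theorems.BalabanUVNodesN15TwoSpacingGluingCutRowsDefectNonlocal
import Summits.QuantumFields.YangMills.Theorems.BalabanUVNodesN15TwoSpacingGluingCutRowsDefectAveraging
import Summits.QuantumFields.YangMills.Theorems.BalabanUVNodesN15NeumannCubeOutputRowDefect
import Summits.QuantumFields.YangMills.Theorems.BalabanUVNodesN15TwoGridLandauDefectFull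
import HarnessLib

/-!
# THE GLUING STEP AT TWO LATTICE SPACINGS, XXXV: THE TWO-GRID η-DEFECT OF THE REMAINDER ROW OF ONE NEUMANN CUBE OF THE COVER ON THE DOUBLED TORUS — EVERY ROW OF FILES 74–76
# INHABITED BY dag-n15-a's PROGRAMME N (N-IIc, N-IIe, N-IIh, N-IIi, the Landau defect), RATE `(L^k)^{−1∕16}`, THE ONE IMAGES-TYPE ROW `𝔇(χ′N_L′G′(□), χN_LG(□))` DISPLAYED
# (dag-n15-c g12, FILE 77; N15 = NE2, s1 «background-layer OPERATOR ingredient»)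

Cell `pub-ymgap`, seat `pub-ymgap-dag-n15-c` (R134 (a); HUMAN RULING D-0062), generation 12.  `bears_on: R4∕N15 · K3⁷ SpineGivenEndpointR13SepCoPH (stmt-QuantumFields-20544)`.
Filed `--supports stmt-QuantumFields-20544 --as helper` — COUNT-NEUTRAL.  Theorems only (0 `def`, 0 `sorry`).  Imports BY NAME FILE 70 (`knitH`, `knitG`, `coverMargin`, `coverMargin_fit`,
`MP_succ_eq`; through it FILE 69 `deltaOp_eq_lapOp_zero_add`, `hasMaj_nonlocalPart`, `bgrad_eq_neg_symbOp`), FILE 74 (`hasMaj_idef_commOp_comp_cover_of`), FILE 75 (`hasMaj_idef_mulOp_nonlocal_of_cut`,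
`hasMaj_idef_nonlocalPart_comp`), FILE 76 (`hasMaj_idef_qq_comp_cover`), dag-n15-a: parts 41∕47 (`ineq110_114_pair`, `hasMaj_gOp_of_ineq`, `hasMaj_grad_of_ineq`, `hasMaj_landauRe`), N-IIIb∕c
(`hasMaj_chiCube_symOp_comp`, `hasMaj_comp_mulOp_chiInt`, `hasMaj_chiCube_grad_neumannCubeG_of`), N-IIf (`hasMaj_chiCube_divAdjOut_neumannCubeG_of`), N-IIb (`neumannCubeG_eq_chiCube`), N-IIc
(`hasMaj_idef_chiCube_neumannCubeG`), N-IIe (`hasMaj_idef_chiCube_grad_neumannCubeG`), N-IIh (`hasMaj_idef_chiCube_divAdjOut_neumannCubeG`), N-IIi (`hasMaj_chiCube_comp_neumannCubeG`),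
`hasMaj_landauDefect_family`; nothing in the tree is modified.

WHAT.  On dag-n15-a's doubled torus `M = MP (paramsOf d L (m+1) k hL)` (`M_ν = 2L·L^m`), cover cube `□_k` (FILE 70 `knitG`, side `L·L^m`, corner `coverCorner M (L^m) L m₀ k`), partition `h_k`
(FILE 70 `knitH`), coarse spacing `n = L^k`, fine spacing `n′ = L^r·L^k`, King's pairing `P`:
* §1 ★ `rpow_sixteenth_facts` (the small factors `n⁻¹, (nw)⁻¹, (L^k)^{−γ∕2} ≤ ε = (L^k)^{−1∕16}`), ★★ `remainderDefectConst_le` (FILE 74's output constant `≤ C_r·ε`, `C_r` uniform in `m, k, r`);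
* §2 ★★★ **`hasMaj_idef_commOp_deltaOp_comp_knitG`**: GIVEN the images-type row `HY` (`𝔇(M_{χ′}∘N_L′∘G′(□_k), M_χ∘N_L∘G(□_k)) ≤ 1_□1_□·m_Y(L^k)^{−1∕16}·e^{−δ_Yd}`, dag-n15-c WANT g12-4), there are
  `δ, C_r > 0` (uniform in `m, k, r` and the cube index) with `𝔇([Δ′_a, M_{h′_k}]G′(□_k), [Δ_a, M_{h_k}]G(□_k)) ≤ 1_□(y′)·C_r(L^k)^{−1∕16}·e^{−δ|y−y′|_T}` for `k ≥ 1`, `4 ≤ L^k` — the `hDK`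
  row of FILE 63 `hasMaj_idef_glued_of_cutRows` for the cover of FILE 70.

HONEST FRAMING ∕ LIMITS.  Block-majorant bookkeeping over LANDED rows at `U ≡ 1` on the doubled-cube torus MODEL; the two-grid DIFFERENCE TEMPLATE of [B9] Thm 3.14 pp.426–427 applied to
[B6] §2's remainder row (2.92)–(2.93) p.239, (2.133)–(2.136) p.247 at the level of SHAPES; the one displayed row `HY` is dag-n15-a's exact images formula with the block-averaging defect on
the differentiable input `Sym∘G∘χ` (their pen).  Nothing of [B5]∕[B6]∕[B9] asserted.  NE2⁺ NOT PRINTED, NOT proved; N15 NOT discharged; counts of record UNMOVED (typed 28∕28 · discharged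
5∕27); one finite 𝕋⁴ at fixed ε per index — NOT infinite volume, NOT OS on ℝ⁴, NOT a mass gap, NOT Clay; R4 closes the conditional finite-𝕋⁴ rung `BalabanLadder.UV` only.  Restate-immune.
-/

noncomputable section

namespace Summit.QuantumFields.YangMills.BalabanUVNodes.N15.Gluing

open Real
open Literature.MathematicalPhysics.QuantumFieldTheory.Balaban1983to89
open Literature.MathematicalPhysics.QuantumFieldTheory.Balaban1983to89.B5Prop11Plancherel (Tor fine)
open Literature.MathematicalPhysics.QuantumFieldTheory.Balaban1983to89.B11SectG (BlockNorm HasMaj RowSum)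
open Literature.MathematicalPhysics.QuantumFieldTheory.Balaban1983to89.T4EtaRateDefect (idef)
open Literature.MathematicalPhysics.QuantumFieldTheory.Balaban1983to89.T4EtaRateCoeffDefect (pull)
open Literature.MathematicalPhysics.QuantumFieldTheory.Balaban1983to89.B6Prop26Gluing (mulOp ind ind_nonneg ind_le_one)
open Literature.MathematicalPhysics.QuantumFieldTheory.Balaban1983to89.B6UnitTorusCarrier (unitTorusGeo triangle254_unitTorusGeo rowSum_unitTorusGeo unitTorusGeo_dist_nonneg)
open Literature.MathematicalPhysics.QuantumFieldTheory.Balaban1983to89.B5SiteBridgeP12 (MP)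
open Literature.MathematicalPhysics.QuantumFieldTheory.King1986.Torus (blockOf tdistT tdistT_nonneg)
open Summit.QuantumFields.YangMills.BalabanUVNodes.N15.VectorPiece (bshiftEquiv kingPrV blkFine)
open Summit.QuantumFields.YangMills.BalabanUVNodes.N15.BackgroundLayer (fgrad bgrad symbOp_sD_eq)
open Summit.QuantumFields.YangMills.BalabanUVNodes.N15.TwoGrid (symbOp sD sTinv paramsOf deltaOp gOp neumannCubeG chiCube cubeBlocks landauRe qvRe qvAdjRe ineq110_114_pair hasMaj_gOp_of_ineq
  hasMaj_grad_of_ineq hasMaj_landauRe hasMaj_chiCube_symOp_comp hasMaj_comp_mulOp_chiInt hasMaj_chiCube_grad_neumannCubeG_of hasMaj_chiCube_divAdjOut_neumannCubeG_of neumannCubeG_eq_chiCube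
  hasMaj_idef_chiCube_neumannCubeG hasMaj_idef_chiCube_grad_neumannCubeG hasMaj_idef_chiCube_divAdjOut_neumannCubeG hasMaj_chiCube_comp_neumannCubeG hasMaj_landauDefect_family)

variable {d : ℕ}

/-! ## §1 The small factors and the compression of the constant -/

section Small

/-- ★ the small factors against `ε = (L^k)^{−1∕16}` for `L^k ≥ 1`, `w ≥ 1`: `n⁻¹ ≤ ε`, `(nw)⁻¹ ≤ ε`, `w⁻¹ ≤ 1`. [folklore] -/
theorem rpow_sixteenth_facts {n w : ℝ} (hn : 1 ≤ n) (hw : 1 ≤ w) :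
    n⁻¹ ≤ n ^ (-(1 / 16 : ℝ)) ∧ (n * w)⁻¹ ≤ n ^ (-(1 / 16 : ℝ)) ∧ w⁻¹ ≤ 1 ∧ 0 ≤ n ^ (-(1 / 16 : ℝ)) := by
  have hn0 : 0 < n := by linarith
  have h1 : n⁻¹ ≤ n ^ (-(1 / 16 : ℝ)) := by
    rw [← Real.rpow_neg_one]
    exact Real.rpow_le_rpow_of_exponent_le hn (by norm_num)
  refine ⟨h1, ?_, inv_le_one_of_one_le₀ hw, Real.rpow_nonneg hn0.le _⟩
  calc (n * w)⁻¹ = n⁻¹ * w⁻¹ := by rw [mul_inv]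
    _ ≤ n⁻¹ * 1 := mul_le_mul_of_nonneg_left (inv_le_one_of_one_le₀ hw) (by positivity)
    _ ≤ n ^ (-(1 / 16 : ℝ)) := by rw [mul_one]; exact h1

/-- ★★ **the compression of FILE 74's constant**: with every cube-side defect letter `∝ ε` and every partition fit `∝ (nw)⁻¹ ≤ ε`, the remainder row's defect constant is `≤ C_r·ε`, `C_r` free
of `w, n, ε`. [folklore] -/
theorem remainderDefectConst_le (d : ℕ) {w n ε β β₁ mG m₁ mc mm cN cr rB RB r₃ R3 : ℝ} (hw : 1 ≤ w) (hn : 0 < n) (hnε : (n * w)⁻¹ ≤ ε) (hβ : 0 ≤ β)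
    (hβ₁ : 0 ≤ β₁) (hcN : 0 ≤ cN) (hcr : 0 ≤ cr) (hmG : mG ≤ mc * ε) (hmG0 : 0 ≤ mG) (hm₁ : m₁ ≤ mm * ε) (hm₁0 : 0 ≤ m₁) (hrB : rB ≤ RB * ε)
    (hr₃ : r₃ ≤ R3 * ε) :
    ((d + 1 : ℕ) * (32 * π ^ 2 / w ^ 2 * mG + (w⁻¹) ^ 2 * (n * w)⁻¹ * (144 * π ^ 3 + 32 * π ^ 3 * (d + 1 : ℕ)) * β +
          2 * (π / w * m₁ + |w⁻¹| * (n * w)⁻¹ * (64 * π ^ 2 + π ^ 2 * (d + 1 : ℕ)) * β₁)) + 0) +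
        (cN * (mG + π * (d + 1) / (n * w) * β) * cr + rB) + r₃ ≤
      ((d + 1 : ℕ) * (32 * π ^ 2 * mc + (144 * π ^ 3 + 32 * π ^ 3 * (d + 1 : ℕ)) * β + 2 * (π * mm + (64 * π ^ 2 + π ^ 2 * (d + 1 : ℕ)) * β₁)) +
        (cN * (mc + π * (d + 1) * β) * cr + RB) + R3) * ε := by
  have hw0 : 0 < w := by linarith
  have hwi0 : 0 ≤ w⁻¹ := by positivity
  have hwi1 : w⁻¹ ≤ 1 := inv_le_one_of_one_le₀ hw
  have hwi2 : (w⁻¹) ^ 2 ≤ 1 := by nlinarith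
  have habs : |w⁻¹| ≤ 1 := by rwa [abs_of_nonneg hwi0]
  have hnw0 : 0 ≤ (n * w)⁻¹ := by positivity
  have h32 : 32 * π ^ 2 / w ^ 2 ≤ 32 * π ^ 2 := div_le_self (by positivity) (by nlinarith)
  have hπw : π / w ≤ π := div_le_self pi_pos.le hw
  have hdiv : π * (d + 1) / (n * w) ≤ π * (d + 1) * ε := by
    rw [div_eq_mul_inv]; exact mul_le_mul_of_nonneg_left hnε (by positivity)
  calc ((d + 1 : ℕ) * (32 * π ^ 2 / w ^ 2 * mG + (w⁻¹) ^ 2 * (n * w)⁻¹ * (144 * π ^ 3 + 32 * π ^ 3 * (d + 1 : ℕ)) * β +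
          2 * (π / w * m₁ + |w⁻¹| * (n * w)⁻¹ * (64 * π ^ 2 + π ^ 2 * (d + 1 : ℕ)) * β₁)) + 0) +
        (cN * (mG + π * (d + 1) / (n * w) * β) * cr + rB) + r₃
      ≤ ((d + 1 : ℕ) * (32 * π ^ 2 * (mc * ε) + 1 * ε * (144 * π ^ 3 + 32 * π ^ 3 * (d + 1 : ℕ)) * β +
          2 * (π * (mm * ε) + 1 * ε * (64 * π ^ 2 + π ^ 2 * (d + 1 : ℕ)) * β₁)) + 0) +
        (cN * (mc * ε + π * (d + 1) * ε * β) * cr + RB * ε) + R3 * ε := by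
        gcongr
    _ = _ := by ring

/-- the block-averaging∕Landau constant `r_B` of FILE 75 §2 with FILE 76's `r_Q` is `≤ R_B·ε` (`n⁻¹ ≤ ε`, `w ≥ 1`). [folklore] -/
theorem rB_le_of {a e n w ε β β₁ CV cr : ℝ} (hnε : n⁻¹ ≤ ε) (hε : 0 ≤ ε) (hw : 1 ≤ w) (he : 0 ≤ e) (hβ : 0 ≤ β) (hβ₁ : 0 ≤ β₁) :
    |a| * (e * e * (n⁻¹ * (1 * β₁ + π / w * β)) + 2 * e * n⁻¹ * (β * e)) + CV * ε * β * cr ≤ (|a| * (e * e * (1 * β₁ + π * β) + 2 * e * (β * e)) + CV * β * cr) * ε := by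
  have hπw : π / w * β ≤ π * β := mul_le_mul_of_nonneg_right (div_le_self pi_pos.le hw) hβ
  have hn0 : (0 : ℝ) ≤ 1 * β₁ + π / w * β := by positivity
  have t1 : n⁻¹ * (1 * β₁ + π / w * β) ≤ ε * (1 * β₁ + π * β) := mul_le_mul hnε (by linarith) hn0 hε
  have t2 : 2 * e * n⁻¹ * (β * e) ≤ 2 * e * ε * (β * e) := mul_le_mul_of_nonneg_right (mul_le_mul_of_nonneg_left hnε (by positivity)) (by positivity)
  have t3 := mul_le_mul_of_nonneg_left (add_le_add (mul_le_mul_of_nonneg_left t1 (mul_nonneg he he)) t2) (abs_nonneg a)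
  calc |a| * (e * e * (n⁻¹ * (1 * β₁ + π / w * β)) + 2 * e * n⁻¹ * (β * e)) + CV * ε * β * cr
      ≤ |a| * (e * e * (ε * (1 * β₁ + π * β)) + 2 * e * ε * (β * e)) + CV * ε * β * cr := add_le_add t3 le_rfl
    _ = _ := by ring

/-- the images-type constant `r₃ = 1·(m_Yε) + o·θ` of FILE 75 §1 is `≤ (m_Y + Kθ)·ε` when `o ≤ Kε`, `θ ≥ 0`. [folklore] -/
theorem r3_le_of {mY ε o K θ : ℝ} (ho : o ≤ K * ε) (hθ : 0 ≤ θ) : 1 * (mY * ε) + o * θ ≤ (1 * mY + K * θ) * ε := by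
  have t := mul_le_mul_of_nonneg_right ho hθ
  calc 1 * (mY * ε) + o * θ ≤ 1 * (mY * ε) + K * ε * θ := add_le_add le_rfl t
    _ = _ := by ring

end Small




/-! ## §2 The remainder row's two-grid defect for one cube of the cover -/

section Row

variable {L : ℕ} [NeZero L]
set_option maxHeartbeats 400000 in
/-- ★★★ **THE TWO-GRID η-DEFECT OF THE REMAINDER ROW OF ONE CUBE OF THE COVER ON THE DOUBLED TORUS** — FILE 74 with every row inhabited by dag-n15-a's PROGRAMME N (N-IIIb∕c, N-IIf coarse
rows; N-IIc, N-IIe, N-IIh cut defects; the nonlocal letter of FILE 69; FILE 75's `r₃` on N-IIi + the displayed images-type row; FILE 75's `r_B` on the Landau defect + FILE 76's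
block-averaging composite), RATE `(L^k)^{−1∕16}`, constants uniform in `m`, `k`, `r` and the cube index. [cite: Balaban1984PropagatorsII, (2.92)–(2.93) p.239, (2.133)–(2.136) p.247
(shapes + mechanism); Balaban1985BackgroundPropagators, Thm 3.14 pp.426–427 (difference template); Balaban1984PropagatorsI, (1.18) p.20, (1.69) p.29, (1.126) p.38 (shapes)] -/
theorem hasMaj_idef_commOp_deltaOp_comp_knitG (hL : Odd L ∧ 1 < L) {a : ℝ} (ha : 0 < a) {δY mY : ℝ} (hδY : 0 < δY) (hmY : 0 ≤ mY)
    (HY : ∀ (m kk r : ℕ) (_hk : 1 ≤ kk) (_hn4 : 4 ≤ L ^ kk) (k : Fin (d + 1) → ZMod (2 * L)),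
        HasMaj (BlockNorm.ofBlocks (unitTorusGeo L kk (MP (paramsOf d L (m + 1) kk hL)))
            (fun b : Tor (fine (L ^ kk) (MP (paramsOf d L (m + 1) kk hL))) × Fin (d + 1) => blockOf (L ^ kk) (MP (paramsOf d L (m + 1) kk hL)) b.1))
          (BlockNorm.ofBlocks (unitTorusGeo L kk (MP (paramsOf d L (m + 1) kk hL)))
            (fun i : Tor (fine (L ^ r * L ^ kk) (MP (paramsOf d L (m + 1) kk hL))) × Fin (d + 1) => blockOf (L ^ r * L ^ kk) (MP (paramsOf d L (m + 1) kk hL)) i.1))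
          (idef (pull (kingPrV L kk r (MP (paramsOf d L (m + 1) kk hL)))) (pull (kingPrV L kk r (MP (paramsOf d L (m + 1) kk hL))))
            (mulOp (chiCube (MP (paramsOf d L (m + 1) kk hL)) (L ^ r * L ^ kk) (coverCorner (MP (paramsOf d L (m + 1) kk hL)) (L ^ m) L (coverMargin L m) k) (L * L ^ m)) ∘ₗ
              ((a • (qvAdjRe (MP (paramsOf d L (m + 1) kk hL)) (L ^ r * L ^ kk) ∘ₗ qvRe (MP (paramsOf d L (m + 1) kk hL)) (L ^ r * L ^ kk)) +
                  (-landauRe (MP (paramsOf d L (m + 1) kk hL)) (L ^ r * L ^ kk))) ∘ₗ knitG d L m kk (L ^ r * L ^ kk) hL a k))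
            (mulOp (chiCube (MP (paramsOf d L (m + 1) kk hL)) (L ^ kk) (coverCorner (MP (paramsOf d L (m + 1) kk hL)) (L ^ m) L (coverMargin L m) k) (L * L ^ m)) ∘ₗ
              ((a • (qvAdjRe (MP (paramsOf d L (m + 1) kk hL)) (L ^ kk) ∘ₗ qvRe (MP (paramsOf d L (m + 1) kk hL)) (L ^ kk)) +
                  (-landauRe (MP (paramsOf d L (m + 1) kk hL)) (L ^ kk))) ∘ₗ knitG d L m kk (L ^ kk) hL a k)))
          (fun y y' => ind ((cubeBlocks (MP (paramsOf d L (m + 1) kk hL)) (coverCorner (MP (paramsOf d L (m + 1) kk hL)) (L ^ m) L (coverMargin L m) k) (L * L ^ m) : Finset _) : Set _) y *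
            ind ((cubeBlocks (MP (paramsOf d L (m + 1) kk hL)) (coverCorner (MP (paramsOf d L (m + 1) kk hL)) (L ^ m) L (coverMargin L m) k) (L * L ^ m) : Finset _) : Set _) y' *
            (mY * ((L ^ kk : ℕ) : ℝ) ^ (-(1 / 16 : ℝ)) * Real.exp (-(δY * tdistT (MP (paramsOf d L (m + 1) kk hL)) y y'))))) :
    ∃ δ Cr : ℝ, 0 < δ ∧ 0 < Cr ∧ ∀ (m kk r : ℕ) (_hk : 1 ≤ kk) (_hn4 : 4 ≤ L ^ kk) (k : Fin (d + 1) → ZMod (2 * L)),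
      HasMaj (BlockNorm.ofBlocks (unitTorusGeo L kk (MP (paramsOf d L (m + 1) kk hL)))
          (fun b : Tor (fine (L ^ kk) (MP (paramsOf d L (m + 1) kk hL))) × Fin (d + 1) => blockOf (L ^ kk) (MP (paramsOf d L (m + 1) kk hL)) b.1))
        (BlockNorm.ofBlocks (unitTorusGeo L kk (MP (paramsOf d L (m + 1) kk hL)))
          (fun i : Tor (fine (L ^ r * L ^ kk) (MP (paramsOf d L (m + 1) kk hL))) × Fin (d + 1) => blockOf (L ^ r * L ^ kk) (MP (paramsOf d L (m + 1) kk hL)) i.1))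
        (idef (pull (kingPrV L kk r (MP (paramsOf d L (m + 1) kk hL)))) (pull (kingPrV L kk r (MP (paramsOf d L (m + 1) kk hL))))
          (commOp (deltaOp (MP (paramsOf d L (m + 1) kk hL)) (L ^ r * L ^ kk) a) (knitH d L m kk (L ^ r * L ^ kk) hL k) ∘ₗ knitG d L m kk (L ^ r * L ^ kk) hL a k)
          (commOp (deltaOp (MP (paramsOf d L (m + 1) kk hL)) (L ^ kk) a) (knitH d L m kk (L ^ kk) hL k) ∘ₗ knitG d L m kk (L ^ kk) hL a k))
        (fun y y' => ind ((cubeBlocks (MP (paramsOf d L (m + 1) kk hL)) (coverCorner (MP (paramsOf d L (m + 1) kk hL)) (L ^ m) L (coverMargin L m) k) (L * L ^ m) : Finset _) : Set _) y' *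
          (Cr * ((L ^ kk : ℕ) : ℝ) ^ (-(1 / 16 : ℝ)) * Real.exp (-(δ * tdistT (MP (paramsOf d L (m + 1) kk hL)) y y')))) := by
  have hLodd : Odd L := hL.1
  have hL2 : 2 ≤ L := hL.2
  have hL3 : 3 ≤ L := by obtain ⟨⟨j, hj⟩, h1⟩ := hL; omega
  have hLpos : 0 < L := by omega
  -- the letters (all uniform)
  obtain ⟨δ₀, C, Cα, Cε, Cαε, hδ₀, hC, H⟩ := ineq110_114_pair (d := d) hL ha
  obtain ⟨δ₁, C₁, hδ₁, hC₁, HL⟩ := hasMaj_landauRe (d := d) (L := L)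
  obtain ⟨δc, mc, hδc, hmc, HC⟩ := hasMaj_idef_chiCube_neumannCubeG (d := d) hLodd hL2 ha (γ := 1 / 8) (by norm_num) (by norm_num)
  obtain ⟨δe, me, hδe, hme, HE⟩ := hasMaj_idef_chiCube_grad_neumannCubeG (d := d) hLodd hL2 ha
  obtain ⟨δh, mh, hδh, hmh, HH⟩ := hasMaj_idef_chiCube_divAdjOut_neumannCubeG (d := d) hLodd hL2 ha
  obtain ⟨δV, CV, hδV, hCV, HV⟩ := hasMaj_landauDefect_family (d := d) hLodd hL2 ha (γ := 1 / 8) (by norm_num) (by norm_num)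
  set δm : ℝ := min (min (min δ₀ δ₁) (min δc δe)) (min (min δh δV) δY) with hδm_def
  have hδm : 0 < δm := lt_min (lt_min (lt_min hδ₀ hδ₁) (lt_min hδc hδe)) (lt_min (lt_min hδh hδV) hδY)
  have hm0 : δm ≤ δ₀ := (min_le_left _ _).trans ((min_le_left _ _).trans (min_le_left _ _))
  have hm1 : δm ≤ δ₁ := (min_le_left _ _).trans ((min_le_left _ _).trans (min_le_right _ _))
  have hmc' : δm ≤ δc := (min_le_left _ _).trans ((min_le_right _ _).trans (min_le_left _ _))
  have hme' : δm ≤ δe := (min_le_left _ _).trans ((min_le_right _ _).trans (min_le_right _ _))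
  have hmh' : δm ≤ δh := (min_le_right _ _).trans ((min_le_left _ _).trans (min_le_left _ _))
  have hmV : δm ≤ δV := (min_le_right _ _).trans ((min_le_left _ _).trans (min_le_right _ _))
  have hmY : δm ≤ δY := (min_le_right _ _).trans (min_le_right _ _)
  set cr : ℝ := B4Sect5Proof.latticeConst (d + 1) (δm / 4) with hcr_def
  have hcr : 0 ≤ cr := B4Sect5Proof.latticeConst_nonneg (d + 1) (by positivity)
  set β : ℝ := 2 ^ (d + 1) * (C * Real.exp δ₀) with hβ_def
  set β₁ : ℝ := 2 ^ (d + 1) * (C * Real.exp δ₀ * Real.exp δ₀) with hβ₁_def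
  set cN : ℝ := |a| * (Real.exp δm * Real.exp δm) + C₁ with hcN_def
  have hβ : 0 ≤ β := by positivity
  have hβ₁ : 0 ≤ β₁ := by positivity
  have hcN : 0 ≤ cN := by positivity
  -- the uniform compressed constant
  set θ : ℝ := 2 ^ (d + 1) * (cN * (C * Real.exp δ₀) * cr) with hθ_def
  set RB : ℝ := |a| * (Real.exp (δm / 4) * Real.exp (δm / 4) * (1 * β₁ + π * β) + 2 * Real.exp (δm / 4) * (β * Real.exp (δm / 4))) + CV * β * cr with hRB_def
  set R3 : ℝ := 1 * mY + π * (d + 1) * θ with hR3_def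
  set Cr : ℝ := ((d + 1 : ℕ) * (32 * π ^ 2 * mc + (144 * π ^ 3 + 32 * π ^ 3 * (d + 1 : ℕ)) * β + 2 * (π * max me mh + (64 * π ^ 2 + π ^ 2 * (d + 1 : ℕ)) * β₁)) +
    (cN * (mc + π * (d + 1) * β) * cr + RB) + R3) + 1 with hCr_def
  have hmax : 0 ≤ max me mh := hme.le.trans (le_max_left _ _)
  refine ⟨δm / 4, Cr, by positivity, by positivity, fun m kk r hk hn4 k => ?_⟩
  -- the index's data
  set M : Fin (d + 1) → ℕ := MP (paramsOf d L (m + 1) kk hL) with hMdef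
  have hM : ∀ ν, M ν = 2 * L * L ^ m := MP_succ_eq L m kk hL
  have hM' : ∀ ν, M ν = 2 * (L * L ^ m) := fun ν => by rw [hM ν, mul_assoc]
  have hw : 0 < L ^ m := pow_pos hLpos m
  have hn : 1 ≤ L ^ kk := Nat.one_le_pow _ _ hLpos
  have hn' : 1 ≤ L ^ r * L ^ kk := Nat.one_le_iff_ne_zero.mpr (Nat.mul_ne_zero (pow_ne_zero r (NeZero.ne L)) (pow_ne_zero kk (NeZero.ne L)))
  have hfit := coverMargin_fit hL3 m
  have hfit1 : coverMargin L m + 2 * L ^ m + 1 ≤ L * L ^ m := by omega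
  have hS : L * L ^ m ≤ 2 * L * L ^ m := by rw [mul_assoc]; omega
  have h3 : 3 ≤ L ^ kk * L ^ m :=
    calc 3 ≤ L := hL3
      _ = L ^ 1 := (pow_one L).symm
      _ ≤ L ^ kk := Nat.pow_le_pow_right hLpos hk
      _ = L ^ kk * 1 := (mul_one _).symm
      _ ≤ L ^ kk * L ^ m := Nat.mul_le_mul_left _ hw
  have hSe : L ^ (m + 1) = L * L ^ m := by rw [pow_succ, mul_comm]
  have hwR : (1 : ℝ) ≤ ((L ^ m : ℕ) : ℝ) := by exact_mod_cast hw
  have hnR : (1 : ℝ) ≤ ((L ^ kk : ℕ) : ℝ) := by exact_mod_cast hn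
  have hnR0 : (0 : ℝ) < ((L ^ kk : ℕ) : ℝ) := by linarith
  set ε : ℝ := ((L ^ kk : ℕ) : ℝ) ^ (-(1 / 16 : ℝ)) with hε_def
  obtain ⟨hnε, hnwε, hw1, hε0⟩ := rpow_sixteenth_facts hnR hwR
  have hexp16 : (-((1 : ℝ) / 8 / 2)) = -(1 / 16 : ℝ) := by norm_num
  set c : Tor M := coverCorner M (L ^ m) L (coverMargin L m) k with hc_def
  have hrow := rowSum_unitTorusGeo (L := L) (k := kk) (M := M) (σ := δm / 4) (by positivity)
  have hblk : (fun i : Tor (fine (L ^ r * L ^ kk) M) × Fin (d + 1) => blockOf (L ^ r * L ^ kk) M i.1) =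
      (fun b : Tor (fine (L ^ kk) M) × Fin (d + 1) => blockOf (L ^ kk) M b.1) ∘ kingPrV L kk r M := (VectorPiece.blkFine_comp_kingPrV (M := M) L kk r).symm
  have hblk' : (fun i : Tor (fine (L ^ r * L ^ kk) (MP (paramsOf d L (m + 1) kk hL))) × Fin (d + 1) => blockOf (L ^ r * L ^ kk) (MP (paramsOf d L (m + 1) kk hL)) i.1) =
      (fun b : Tor (fine (L ^ kk) M) × Fin (d + 1) => blockOf (L ^ kk) M b.1) ∘ kingPrV L kk r M := hblk
  have hind : ∀ y y' : Tor M, 0 ≤ ind (g := unitTorusGeo L kk M) ((cubeBlocks M c (L * L ^ m) : Finset (Tor M)) : Set (Tor M)) y *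
      ind (g := unitTorusGeo L kk M) ((cubeBlocks M c (L * L ^ m) : Finset (Tor M)) : Set (Tor M)) y' := fun y y' => mul_nonneg (ind_nonneg _ _) (ind_nonneg _ _)
  -- the torus letters at both spacings
  have Hk := (H (m + 1) kk r hk).1
  have hG := hasMaj_gOp_of_ineq (L := L) (k := kk) M (L ^ kk) a hn Hk hC.le
  have hD := fun ν => hasMaj_grad_of_ineq (L := L) (k := kk) M (L ^ kk) a hn Hk hC.le ν
  have hNLc := hasMaj_nonlocalPart (L := L) (kk := kk) (M := M) (n := L ^ kk) (a := a) hC₁.le hδm.le hm1 (HL kk (L ^ kk) M)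
  have hNL' := hasMaj_nonlocalPart (L := L) (kk := kk) (M := M) (n := L ^ r * L ^ kk) (a := a) hC₁.le hδm.le hm1 (HL kk (L ^ r * L ^ kk) M)
  -- the coarse cut rows (N-IIIb, N-IIIc, N-IIf), weakened to the rate `δm ∕ 2`
  have hGc0 : HasMaj (BlockNorm.ofBlocks (unitTorusGeo L kk M) (fun b : Tor (fine (L ^ kk) M) × Fin (d + 1) => blockOf (L ^ kk) M b.1))
      (BlockNorm.ofBlocks (unitTorusGeo L kk M) (fun b : Tor (fine (L ^ kk) M) × Fin (d + 1) => blockOf (L ^ kk) M b.1))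
      (mulOp (chiCube M (L ^ kk) c (L * L ^ m)) ∘ₗ knitG d L m kk (L ^ kk) hL a k)
      (fun y y' => ind ((cubeBlocks M c (L * L ^ m) : Finset (Tor M)) : Set (Tor M)) y * ind ((cubeBlocks M c (L * L ^ m) : Finset (Tor M)) : Set (Tor M)) y' *
        (β * Real.exp (-(δ₀ * tdistT M y y')))) :=
    hasMaj_chiCube_symOp_comp (L := L) (k := kk) (c := c) (S := L * L ^ m) hC.le hδ₀.le hM' (hasMaj_comp_mulOp_chiInt (c := c) (S := L * L ^ m) hC.le hG)
  have hGc := hasMaj_rate_le (hind) hβ (by linarith : δm / 2 ≤ δ₀) hGc0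
  have hDc : ∀ μ, HasMaj (BlockNorm.ofBlocks (unitTorusGeo L kk M) (fun b : Tor (fine (L ^ kk) M) × Fin (d + 1) => blockOf (L ^ kk) M b.1))
      (BlockNorm.ofBlocks (unitTorusGeo L kk M) (fun b : Tor (fine (L ^ kk) M) × Fin (d + 1) => blockOf (L ^ kk) M b.1))
      (mulOp (chiCube M (L ^ kk) c (L * L ^ m)) ∘ₗ (fgrad ((L ^ kk : ℕ) : ℝ) (bshiftEquiv M (L ^ kk) μ) ∘ₗ knitG d L m kk (L ^ kk) hL a k))
      (fun y y' => ind ((cubeBlocks M c (L * L ^ m) : Finset (Tor M)) : Set (Tor M)) y * ind ((cubeBlocks M c (L * L ^ m) : Finset (Tor M)) : Set (Tor M)) y' *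
        (β₁ * Real.exp (-(δm / 2 * tdistT M y y')))) := fun μ => by
    have h := hasMaj_chiCube_grad_neumannCubeG_of (L := L) (k := kk) (c := c) (S := L * L ^ m) hM' hC hδ₀ μ (hD μ)
    rw [symbOp_sD_eq] at h
    exact hasMaj_rate_le (hind) hβ₁ (by linarith : δm / 2 ≤ δ₀) h
  have hDbc : ∀ μ, HasMaj (BlockNorm.ofBlocks (unitTorusGeo L kk M) (fun b : Tor (fine (L ^ kk) M) × Fin (d + 1) => blockOf (L ^ kk) M b.1))
      (BlockNorm.ofBlocks (unitTorusGeo L kk M) (fun b : Tor (fine (L ^ kk) M) × Fin (d + 1) => blockOf (L ^ kk) M b.1))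
      (mulOp (chiCube M (L ^ kk) c (L * L ^ m)) ∘ₗ (bgrad ((L ^ kk : ℕ) : ℝ) (bshiftEquiv M (L ^ kk) μ) ∘ₗ knitG d L m kk (L ^ kk) hL a k))
      (fun y y' => ind ((cubeBlocks M c (L * L ^ m) : Finset (Tor M)) : Set (Tor M)) y * ind ((cubeBlocks M c (L * L ^ m) : Finset (Tor M)) : Set (Tor M)) y' *
        (β₁ * Real.exp (-(δm / 2 * tdistT M y y')))) := fun μ => by
    have h := (hasMaj_rate_le (hind) hβ₁ (by linarith : δm / 2 ≤ δ₀)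
      (hasMaj_chiCube_divAdjOut_neumannCubeG_of (L := L) (k := kk) (c := c) (S := L * L ^ m) hM' hC.le hδ₀.le μ (hD μ))).neg
    rw [bgrad_eq_neg_symbOp, LinearMap.neg_comp, LinearMap.comp_neg]
    exact h
  -- the cut defect rows (N-IIc, N-IIe, N-IIh), weakened to `δm ∕ 2`, constants `mc ε`, `max me mh · ε`
  have hIGc0 := HC (m + 1) kk r hk hL c
  rw [hSe, hexp16] at hIGc0
  have hIGc := hasMaj_rate_le (hind) (by positivity : 0 ≤ mc * ε) (by linarith : δm / 2 ≤ δc) hIGc0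
  have hIDc : ∀ μ, HasMaj (BlockNorm.ofBlocks (unitTorusGeo L kk M) (fun b : Tor (fine (L ^ kk) M) × Fin (d + 1) => blockOf (L ^ kk) M b.1))
      (BlockNorm.ofBlocks (unitTorusGeo L kk M) (fun i : Tor (fine (L ^ r * L ^ kk) M) × Fin (d + 1) => blockOf (L ^ r * L ^ kk) M i.1))
      (idef (pull (kingPrV L kk r M)) (pull (kingPrV L kk r M))
        (mulOp (chiCube M (L ^ r * L ^ kk) c (L * L ^ m)) ∘ₗ (fgrad ((L ^ r * L ^ kk : ℕ) : ℝ) (bshiftEquiv M (L ^ r * L ^ kk) μ) ∘ₗ knitG d L m kk (L ^ r * L ^ kk) hL a k))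
        (mulOp (chiCube M (L ^ kk) c (L * L ^ m)) ∘ₗ (fgrad ((L ^ kk : ℕ) : ℝ) (bshiftEquiv M (L ^ kk) μ) ∘ₗ knitG d L m kk (L ^ kk) hL a k)))
      (fun y y' => ind ((cubeBlocks M c (L * L ^ m) : Finset (Tor M)) : Set (Tor M)) y * ind ((cubeBlocks M c (L * L ^ m) : Finset (Tor M)) : Set (Tor M)) y' *
        (max me mh * ε * Real.exp (-(δm / 2 * tdistT M y y')))) := fun μ => by
    have h := HE (m + 1) kk r hk hn4 hL c μ
    rw [hSe, symbOp_sD_eq, symbOp_sD_eq] at h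
    exact (hasMaj_rate_le (hind) (by positivity : 0 ≤ me * ε) (by linarith : δm / 2 ≤ δe) h).mono fun y y' =>
      mul_le_mul_of_nonneg_left (mul_le_mul_of_nonneg_right (mul_le_mul_of_nonneg_right (le_max_left _ _) hε0) (Real.exp_nonneg _)) (hind y y')
  have hIDbc : ∀ μ, HasMaj (BlockNorm.ofBlocks (unitTorusGeo L kk M) (fun b : Tor (fine (L ^ kk) M) × Fin (d + 1) => blockOf (L ^ kk) M b.1))
      (BlockNorm.ofBlocks (unitTorusGeo L kk M) (fun i : Tor (fine (L ^ r * L ^ kk) M) × Fin (d + 1) => blockOf (L ^ r * L ^ kk) M i.1))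
      (idef (pull (kingPrV L kk r M)) (pull (kingPrV L kk r M))
        (mulOp (chiCube M (L ^ r * L ^ kk) c (L * L ^ m)) ∘ₗ (bgrad ((L ^ r * L ^ kk : ℕ) : ℝ) (bshiftEquiv M (L ^ r * L ^ kk) μ) ∘ₗ knitG d L m kk (L ^ r * L ^ kk) hL a k))
        (mulOp (chiCube M (L ^ kk) c (L * L ^ m)) ∘ₗ (bgrad ((L ^ kk : ℕ) : ℝ) (bshiftEquiv M (L ^ kk) μ) ∘ₗ knitG d L m kk (L ^ kk) hL a k)))
      (fun y y' => ind ((cubeBlocks M c (L * L ^ m) : Finset (Tor M)) : Set (Tor M)) y * ind ((cubeBlocks M c (L * L ^ m) : Finset (Tor M)) : Set (Tor M)) y' *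
        (max me mh * ε * Real.exp (-(δm / 2 * tdistT M y y')))) := fun μ => by
    have h := HH (m + 1) kk r hk hn4 hL c μ
    rw [hSe] at h
    rw [bgrad_eq_neg_symbOp, bgrad_eq_neg_symbOp, LinearMap.neg_comp, LinearMap.comp_neg, LinearMap.neg_comp, LinearMap.comp_neg, idef_neg]
    exact ((hasMaj_rate_le (hind) (by positivity : 0 ≤ mh * ε) (by linarith : δm / 2 ≤ δh) h).mono fun y y' =>
      mul_le_mul_of_nonneg_left (mul_le_mul_of_nonneg_right (mul_le_mul_of_nonneg_right (le_max_right _ _) hε0) (Real.exp_nonneg _)) (hind y y')).neg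
  -- the partition: cuts, bound, fit
  have hχ := chiCube_coverCorner_eq_one_side (M := M) (n := L ^ kk) (m₀ := coverMargin L m) hM hw hfit1 hS 0 k
  have hχ' := chiCube_coverCorner_eq_one_side (M := M) (n := L ^ r * L ^ kk) (m₀ := coverMargin L m) hM hw hfit1 hS 0 k
  have hcut := hcube_cut (2 * L) (coverXi M (L ^ kk) (L ^ m)) (bshiftEquiv M (L ^ kk)) 0 hχ
  have hcut' := hcube_cut (2 * L) (coverXi M (L ^ r * L ^ kk) (L ^ m)) (bshiftEquiv M (L ^ r * L ^ kk)) 0 hχ'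
  have hh : ∀ x, |knitH d L m kk (L ^ kk) hL k x| ≤ 1 := fun x => abs_coverH_le_one k x
  have hh' : ∀ x', |knitH d L m kk (L ^ r * L ^ kk) hL k x'| ≤ 1 := fun x' => abs_coverH_le_one k x'
  have hfitH : ∀ x', |knitH d L m kk (L ^ r * L ^ kk) hL k x' - knitH d L m kk (L ^ kk) hL k (kingPrV L kk r M x')| ≤ π * (d + 1) / (((L ^ kk : ℕ) : ℝ) * ((L ^ m : ℕ) : ℝ)) :=
    fun x' => abs_coverH_fine_sub_le (L := L) (kk := kk) (r := r) hM hw k x'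
  -- `r₃`: N-IIi behind the cut + the displayed images-type row
  have hY := hasMaj_chiCube_comp_neumannCubeG (L := L) (k := kk) (n := L ^ kk) (c := c) (S := L * L ^ m) (a := a)
    (T₁ := a • (qvAdjRe M (L ^ kk) ∘ₗ qvRe M (L ^ kk)) + (-landauRe M (L ^ kk))) hM' (triangle254_unitTorusGeo L kk M) hrow hC.le hδ₀.le hcN
    (by positivity : 0 ≤ δm / 2) (by linarith : δm / 2 ≤ δ₀) (by linarith : δm / 2 + δm / 4 ≤ δm) hNLc hG
  have hIY0 := HY m kk r hk hn4 k
  have hIY := hasMaj_rate_le (hind) (by positivity : 0 ≤ mY * ε) (by linarith : δm / 2 ≤ δY) hIY0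
  rw [hblk] at hIY
  have hD3 := hasMaj_idef_mulOp_nonlocal_of_cut (g := unitTorusGeo L kk M) (fun b : Tor (fine (L ^ kk) M) × Fin (d + 1) => blockOf (L ^ kk) M b.1) (kingPrV L kk r M)
    (by positivity : (0 : ℝ) ≤ π * (d + 1) / (((L ^ kk : ℕ) : ℝ) * ((L ^ m : ℕ) : ℝ))) hcut hcut' hh' hfitH hY hIY
  rw [← hblk] at hD3
  -- `r_B`: the Landau operator defect and the block-averaging composite
  have hV0 := HV (m + 1) kk r hk hL
  rw [hexp16, hblk'] at hV0
  have hNχ : knitG d L m kk (L ^ kk) hL a k ∘ₗ mulOp (chiCube M (L ^ kk) c (L * L ^ m)) = knitG d L m kk (L ^ kk) hL a k := by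
    have hχχ : mulOp (chiCube M (L ^ kk) c (L * L ^ m)) ∘ₗ mulOp (chiCube M (L ^ kk) c (L * L ^ m)) = mulOp (chiCube M (L ^ kk) c (L * L ^ m)) :=
      mulOp_comp_mulOp_of_support fun x hx => by
        unfold chiCube at hx ⊢
        by_cases hp : blockOf (L ^ kk) M x.1 ∈ cubeBlocks M c (L * L ^ m)
        · rw [if_pos hp]
        · rw [if_neg hp] at hx; exact absurd rfl hx
    show neumannCubeG M (L ^ kk) c (L * L ^ m) a ∘ₗ mulOp (chiCube M (L ^ kk) c (L * L ^ m)) = neumannCubeG M (L ^ kk) c (L * L ^ m) a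
    rw [neumannCubeG_eq_chiCube M (L ^ kk) c (L * L ^ m) a hM' hn ha, LinearMap.comp_assoc, LinearMap.comp_assoc, hχχ]
  have hQ := hasMaj_idef_qq_comp_cover (L := L) (kk := kk) (r := r) hM hw hfit1 hS k hβ hβ₁ (by positivity : 0 ≤ δm / 4) (by linarith : δm / 4 ≤ δ₀) hNχ hGc0
    (fun μ => by
      have h := hasMaj_chiCube_grad_neumannCubeG_of (L := L) (k := kk) (c := c) (S := L * L ^ m) hM' hC hδ₀ μ (hD μ)
      rw [symbOp_sD_eq] at h
      exact h)
  rw [hblk] at hQ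
  have hT3 := hasMaj_idef_nonlocalPart_comp (g := unitTorusGeo L kk M) (fun b : Tor (fine (L ^ kk) M) × Fin (d + 1) => blockOf (L ^ kk) M b.1) (kingPrV L kk r M)
    (triangle254_unitTorusGeo L kk M) (unitTorusGeo_dist_nonneg L kk M) hrow (a := a)
    (by positivity : 0 ≤ Real.exp (δm / 4) * Real.exp (δm / 4) * ((((L ^ kk : ℕ) : ℝ))⁻¹ * (1 * β₁ + π / ((L ^ m : ℕ) : ℝ) * β)) +
      2 * Real.exp (δm / 4) / (L : ℝ) ^ kk * (β * Real.exp (δm / 4)))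
    (by positivity : 0 ≤ CV * ε) hβ (by positivity : 0 ≤ δm / 4) (by linarith : δm / 4 ≤ δm / 2) (by linarith : δm / 4 + δm / 4 ≤ δV) hh hGc hV0 hQ
  rw [← hblk] at hT3
  -- FILE 74
  rw [deltaOp_eq_lapOp_zero_add (M := M) (n := L ^ r * L ^ kk) a, deltaOp_eq_lapOp_zero_add (M := M) (n := L ^ kk) a]
  have key := hasMaj_idef_commOp_comp_cover_of (L := L) (kk := kk) (r := r) (M := M) hM hw hfit hS h3 k hβ hβ₁ (by positivity : 0 ≤ mc * ε)
    (by positivity : 0 ≤ max me mh * ε) hcN (by positivity) (by positivity : 0 ≤ δm / 4) (by linarith : δm / 4 ≤ δm / 2) (by linarith : δm / 4 + δm / 4 ≤ δm) hrow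
    hGc hDc hDbc hIGc hIDc hIDbc hNL' hT3 hD3
  refine key.mono fun y y' => mul_le_mul_of_nonneg_left (mul_le_mul_of_nonneg_right ?_ (Real.exp_nonneg _)) (ind_nonneg _ _)
  clear key hT3 hD3 hQ hV0 hIY hIY0 hY hNχ hIDbc hIDc hIGc hIGc0 hDbc hDc hGc hGc0 hNL' hNLc hD hG Hk hfitH hh hh' hcut hcut' hχ hχ' HY HC HE HH HV H HL hrow hblk' hblk hind
  -- the compression
  have hLk : 2 * Real.exp (δm / 4) / (L : ℝ) ^ kk = 2 * Real.exp (δm / 4) * (((L ^ kk : ℕ) : ℝ))⁻¹ := by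
    rw [div_eq_mul_inv]; push_cast; ring
  rw [hLk]
  have hrB := rB_le_of (a := a) (CV := CV) (cr := cr) hnε hε0 hwR (Real.exp_nonneg (δm / 4)) hβ hβ₁
  have ho : π * (d + 1) / (((L ^ kk : ℕ) : ℝ) * ((L ^ m : ℕ) : ℝ)) ≤ π * (d + 1) * ε := by
    rw [div_eq_mul_inv]; exact mul_le_mul_of_nonneg_left hnwε (by positivity)
  have hr₃ := r3_le_of (mY := mY) ho (by positivity : (0 : ℝ) ≤ 2 ^ (d + 1) * (cN * (C * Real.exp δ₀) * cr))
  have hcomp := remainderDefectConst_le d (mc := mc) (mm := max me mh) (RB := RB) (R3 := R3) hwR hnR0 hnwε hβ hβ₁ hcN hcr (le_refl (mc * ε)) (by positivity)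
    (le_refl (max me mh * ε)) (by positivity) hrB hr₃
  refine hcomp.trans ?_
  rw [hCr_def, add_mul _ (1 : ℝ) ε, one_mul]
  exact le_add_of_nonneg_right hε0

end Row

end Summit.QuantumFields.YangMills.BalabanUVNodes.N15.Gluing

end
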